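import Summits.CriticalPhenomena.Ising3DConformalLimit.Theorems.PrecisionLaplacianMoebiusLimitOfTwoPointLawDyadicReduction
import Summits.CriticalPhenomena.Ising3DConformalLimit.Theorems.PrecisionLaplacianMoebiusLimitOfTwoPointLawSplit
import Literature.Probability.LatticeModels.GKSInequalities
import Literature.Probability.LatticeModels.LebowitzInequality
import Literature.Probability.LatticeModels.CriticalTwoPointLawDimension
import Literature.Barriers.CriticalPhenomena.ScaleCovarianceNotMoebius
import Summits.CriticalPhenomena.Ising3DConformalLimit.Theorems.PrecisionLaplacianMoebiusLimitOfTwoPointLawMonopoleLowerBound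
import Summits.CriticalPhenomena.Ising3DConformalLimit.Theorems.PrecisionLaplacianMoebiusLimitOfTwoPointLawNarrowFamilyNoVertexMeasure
import Summits.CriticalPhenomena.Ising3DConformalLimit.Theorems.PrecisionLaplacianMoebiusLimitOfTwoPointLawKelvinTransform
import Summits.CriticalPhenomena.Ising3DConformalLimit.Theorems.PrecisionLaplacianMoebiusLimitOfTwoPointLawCondCubicNonpos
import Summits.CriticalPhenomena.Ising3DConformalLimit.Theorems.PrecisionLaplacianInverseMFerromagnetImDeg3OfNonadj
import Summits.CriticalPhenomena.Ising3DConformalLimit.Theorems.PrecisionLaplacianInverseMFerromagnetImOfImDeg3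
import Summits.CriticalPhenomena.Ising3DConformalLimit.Theorems.PrecisionLaplacianInverseMFerromagnetRowDegLeTwo
import Summits.CriticalPhenomena.Ising3DConformalLimit.Theorems.PrecisionLaplacianMoebiusLimitOfTwoPointLawAmpLebDegenerate
import Summits.CriticalPhenomena.Ising3DConformalLimit.Theorems.PrecisionLaplacianMoebiusLimitOfTwoPointLawAmpLebMemOfInverseM
import Summits.CriticalPhenomena.Ising3DConformalLimit.Theorems.PrecisionLaplacianMoebiusLimitOfTwoPointLawAmpLebTriangleLimit
import Summits.CriticalPhenomena.Ising3DConformalLimit.Theorems.PrecisionLaplacianMoebiusLimitOfTwoPointLawAmpLebTriangleOfInverseM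
import Summits.CriticalPhenomena.Ising3DConformalLimit.Theorems.PrecisionLaplacianMoebiusLimitOfTwoPointLawAmpLebImNonadj
import HarnessLib

/-!
# Line `Sketch` (card `amputated-lebowitz-vertex-measure`, crux-ideate r2 k4) — skeleton v1.5 (lead c19, 2026-08-17: + item-level exact residue `crux ↔ (0634 → 4738 ∧ 1982)` and split glue LANDED p157903, `stub_vertexMeasureOfLimit` re-diagnosed, line ruled under L5 clause 3 — see `Lines/Sketch.dead.md`; v1.4 lead c18: the VP¹ ≡ IM programme LANDED — teeth `stub_imNonadj_of_amputatedLebowitz`, `stub_inverseM_of_amputatedLebowitz`, `stub_amputatedLebowitz_degenerate`, `stub_amputatedLebowitz_mem_of_inverseM`, `stub_amputatedLebowitz_triangle_of_inverseM`, `stub_amputatedLebowitz_of_triangle_limit`, glue `amputatedLebowitz_iff_inverseM`; v1.2 lead c17: + tooth stub_condCubicNonpos = F4, proved; v1.1 lead c15, 3 of 8 stubs landed)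
# Crux stmt-CriticalPhenomena-4801 `PrecisionLaplacian.MoebiusLimitOfTwoPointLaw` (item 0634 → item 1344)

v1.5 (lead c19). (i) Item stmt-CriticalPhenomena-8367 `RotationUpgradeFromTwoPoint` is now a theorem of the tree, so the
item-level residue of the crux is EXACTLY two existing open items: `crux_iff_subs : crux ↔ (0634 → 4738 ∧ 1982)` below
(re-export of `moebiusLimitOfTwoPointLaw_iff_subs`, Theorems/PrecisionLaplacianMoebiusLimitOfTwoPointLawSplit.lean, p157903,
which also lands the planners' split glue `MoebiusLimitOfTwoPointLaw_of_subs : LimitExists → InversionUpgradeNormalised → crux`).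
(ii) `stub_vertexMeasureOfLimit`: continuity of every dyadic locally uniform limit of `criticalCorr 3` is FREE
(`continuousOn_seqLimit`, Theorems/HyperoctahedralRPExistsScaleCovariantLimitDyadicLimitContinuous.lean), and the pointwise
identity follows from an infinite-volume charge representation by Fatou (`U^ν ≤ −U₄ᶜᵒⁿᵗ < ∞` everywhere ⇒ no atoms), Riemann
sums against test functions (a.e. identity; kernel exponent `2Δ ≤ 2 < 3`) and ball averaging + dominated convergence; what the
stub hides is the passage `Λ ↑ ℤ³` WITHOUT escaped boundary/ghost charge (a Liouville property of the critical precision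
operator) — i.e. its honest lattice input is VP¹ for the plus state on `ℤ³` itself, not for finite systems. (iii) Every open stub
is an existing open item by a kernel theorem (D₂ = 4738 under 0634, p128256; VP¹ ⇔ 4798, p156124; (c)₄ / I₂|₆₊ = clause (c) of
the crux, p128000/p157903): no registered stub is delegable, wave none; ruling L5 clause 3 (`Lines/Sketch.dead.md`).

v1.3/v1.4 (lead c18; v1.4 = all five teeth LANDED p153868 p153959 p154115 p155155 p155838, `amputatedLebowitz_iff_inverseM` sorry-free). The line's one unclassified stub, the lattice conjecture VP¹ `stub_amputatedLebowitz`, is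
EQUIVALENT to the neighbouring crux `PrecisionLaplacian.InverseMFerromagnet` (IM, stmt-CriticalPhenomena-4798) by two
exact finite identities (numerically checked to 1e-16, `vp/ghost_check.py` of the lead folder):
(E1) for a site `y` in at most three bonds, with neighbours `B`, and `x ∉ B ∪ {y}` non-adjacent to `y`:
`PCov(x,y | rest) = κ_y · Res_rest(σ^B, σ_x)` with `κ_y ≤ 0` the cubic Walsh coefficient of `tanh h_y`
(`c2_three` of the 4798 chain) and `Res_rest(σ^B, σ_x) = β_B(x) · Schur(x | rest)` computed in the star–triangle
decimation of `y`, where `β_B(x) = −ν_B(x)` is minus the VP¹ charge — so VP¹ gives IM at every non-adjacent pair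
with ONE endpoint of degree `≤ 3` (`stub_imNonadj_of_amputatedLebowitz`), and the landed bridges C3/C4/C5 of the
4798 chain (`stub_row_deg_le_two` p99845, `stub_imDeg3_of_nonadj` p100050, `stub_im_of_imDeg3` p99785) give IM
(`stub_inverseM_of_amputatedLebowitz`); (Ghost) IM at `(z, g)` for a ghost `g` coupled `ε` to a distinct triple
`X ∌ z` is exactly VP¹`(z ∉ X)` for the system with the `X`-triangle raised by `λ(ε) = ¼ log(cosh 3ε / cosh ε) ↓ 0`
(`stub_amputatedLebowitz_triangle_of_inverseM`), continuity `ε → 0⁺` removes the triangle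
(`stub_amputatedLebowitz_of_triangle_limit`), VP¹`(z ∈ X)` is IM + GKS-II termwise
(`stub_amputatedLebowitz_mem_of_inverseM`) and coincident triples are explicit (`stub_amputatedLebowitz_degenerate`).
Glue: `amputatedLebowitz_iff_inverseM : VP¹ ↔ InverseMFerromagnet` (sorry-free modulo these teeth). Consequence for
the line: every open stub is then an existing open item by a kernel theorem (D₂ = 4738 under 0634, p128256; VP¹ = 4798;
`stub_vertexCovariance` = (c)₄ ⊂ 1982; `stub_inversionHigher` = I₂|₆₊ ⊂ 1982/1344).

Composition. The crux is EXACTLY `D₂ ∧ I₂` (landed, p128000: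
`moebiusLimitOfTwoPointLaw_of_dyadic : D₂ → I₂ → crux`; D₂ = dyadic canonical existence of the even
arities `n ≥ 4`, I₂ = unit-inversion covariance, weight `Δ`, of every dyadic canonical limit). This line
keeps `D₂` as a stub by name (`stub_dyadicLimit`, shared with line `SketchIdeator5R2`) and FACTORS `I₂`:
* at `n = 4` through the card's vertex-measure programme —
  `stub_amputatedLebowitz` (VP¹, the new LATTICE inequality: one-leg precision amputation of `U₄` keeps the
  Lebowitz sign, for every finite zero-field pair ferromagnet) →
  `stub_vertexMeasureOfLimit` (VP¹ + the two-point law ⇒ for every dyadic canonical limit `T₄`,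
  `T₄ − (Wick part with two-point function c‖·‖^{-2Δ}) = −∫ c‖x₁ − z‖^{-2Δ} dν_X(z)` with `ν_X ≥ 0` finite,
  no atom at the origin for triples off the origin) →
  `stub_vertexCovariance` (CRUX-SIZED: the vertex measures transform under the unit inversion by the
  Kelvin law `ν_{ιX} = (∏ⱼ‖Xⱼ‖^{2Δ}) · ι_*(‖z‖^{-2Δ} ν_X)`) →
  `stub_inversionOfVertexCovariance` (LANDED p129418: Kelvin transform of Riesz potentials of positive
  measures + covariance of the Wick part ⇒ `T₄ (ι x) = ∏‖xᵢ‖^{2Δ} T₄ x`);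
* at even `n ≥ 6` by name: `stub_inversionHigher` (CRUX-SIZED; the card offers only the conjectural
  amputated Shlosman hierarchy).
Teeth against the catalogued barrier (D-0021), registered so that they can be landed `--supports`:
`stub_monopoleLowerBound` (LANDED p129240; positive Riesz potentials of non-zero finite measures decay no faster than
`‖x‖^{-2Δ}`) and `stub_narrowFamilyNoVertexMeasure` (LANDED p129317) (the witness `ScaleNotMoebius.narrowFamily` of
`Literature.Barriers.CriticalPhenomena.ScaleCovarianceNotMoebius(Narrow)` has NO vertex measure: VP¹'s
continuum form lies outside the barrier's technique class). They are not used by `MoebiusLimitOfTwoPointLaw_of`.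
-/

noncomputable section

namespace Summit.CriticalPhenomena.Ising3DConformalLimit.Cruxes.MoebiusLimitOfTwoPointLaw.AmputatedLebowitz

open Literature.Probability.LatticeModels Filter Topology EuclideanGeometry MeasureTheory
open Summit.CriticalPhenomena.Ising3DConformalLimit.Theses.PrecisionLaplacian (MoebiusLimitOfTwoPointLaw)
open Summit.CriticalPhenomena.Ising3DConformalLimit.PrecisionLaplacianMoebiusLimitOfTwoPointLaw
  (moebiusLimitOfTwoPointLaw_of_dyadic)

/-! ## Stubs -/

/-- **Stub D₂ (dyadic canonical existence, even arities `n ≥ 4`)** — shared verbatim with line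
`SketchIdeator5R2`. OPEN (one-hierarchy existence of the critical `ℤ³` scaling limit; below items 4738/1981). -/
theorem stub_dyadicLimit :
    ∀ Δ c : ℝ, 0 < c →
      Tendsto (fun x : Site 3 =>
        criticalTwoPoint 3 x * Real.sqrt (∑ i, ((x i : ℝ)) ^ 2) ^ (2 * Δ)) cofinite (nhds c) →
      ∀ n, 4 ≤ n → Even n → ∃ Tn : (Fin n → EuclideanSpace ℝ (Fin 3)) → ℝ,
        TendstoLocallyUniformlyOn
          (fun k : ℕ => rescaledCorrelator (criticalCorr 3) (fun δ => δ ^ (-Δ)) n (((2:ℝ) ^ k)⁻¹))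
          Tn atTop (NonCoincident 3 n) := by
  sorry

/-- **Stub VP¹ (amputated Lebowitz; the line's new lattice input, conjectural).** For every finite
zero-field pair ferromagnet (`gksExpect` vocabulary, as in `PrecisionLaplacian.InverseMFerromagnet`), every site
`z` and every triple `x₂ x₃ x₄`: `∑ₐ (Σ⁻¹)_{z a} · (−U₄(a; x₂,x₃,x₄)) ≥ 0`, `Σ = (⟨σ_p σ_q⟩)_{p q}`,
`−U₄ = ⟨σ_aσ₂⟩⟨σ₃σ₄⟩ + ⟨σ_aσ₃⟩⟨σ₂σ₄⟩ + ⟨σ_aσ₄⟩⟨σ₂σ₃⟩ − ⟨σ_aσ₂σ₃σ₄⟩`. -/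
theorem stub_amputatedLebowitz :
    ∀ (n m : ℕ) (K : Fin m → ℝ) (C : Fin m → Finset (Fin n)), (∀ i, 0 ≤ K i) → (∀ i, (C i).card = 2) →
      ∀ z x₂ x₃ x₄ : Fin n,
        0 ≤ ∑ a : Fin n,
          (Matrix.of fun (p q : Fin n) =>
              gksExpect Finset.univ K C (fun ω => spinAt p ω * spinAt q ω))⁻¹ z a *
            (gksExpect Finset.univ K C (fun ω => spinAt a ω * spinAt x₂ ω) *
                gksExpect Finset.univ K C (fun ω => spinAt x₃ ω * spinAt x₄ ω) +
              gksExpect Finset.univ K C (fun ω => spinAt a ω * spinAt x₃ ω) *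
                gksExpect Finset.univ K C (fun ω => spinAt x₂ ω * spinAt x₄ ω) +
              gksExpect Finset.univ K C (fun ω => spinAt a ω * spinAt x₄ ω) *
                gksExpect Finset.univ K C (fun ω => spinAt x₂ ω * spinAt x₃ ω) -
              gksExpect Finset.univ K C
                (fun ω => spinAt a ω * spinAt x₂ ω * spinAt x₃ ω * spinAt x₄ ω)) := by
  sorry

/-- **Stub (vertex measures of dyadic limits; transfer of VP¹ to the continuum under the two-point
law).** VP¹ ⇒ for every witness `(Δ,c)` of item 0634 and every dyadic canonical limit `T₄` of arity 4
there is a family of finite positive measures `ν X` (one per triple `X`), without atom at the origin when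
`X` avoids the origin, such that at every non-coincident `(x₁, X)`:
`T₄(x₁,X) − c²·Wick(x₁,X) = −∫ c‖x₁ − z‖^{-2Δ} dν_X(z)` (kernel `ν_X`-integrable there). OPEN here
(vague limits of the rescaled lattice vertex charges; M on paper, large in Lean). -/
theorem stub_vertexMeasureOfLimit :
    (∀ (n m : ℕ) (K : Fin m → ℝ) (C : Fin m → Finset (Fin n)), (∀ i, 0 ≤ K i) → (∀ i, (C i).card = 2) →
      ∀ z x₂ x₃ x₄ : Fin n,
        0 ≤ ∑ a : Fin n,
          (Matrix.of fun (p q : Fin n) =>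
              gksExpect Finset.univ K C (fun ω => spinAt p ω * spinAt q ω))⁻¹ z a *
            (gksExpect Finset.univ K C (fun ω => spinAt a ω * spinAt x₂ ω) *
                gksExpect Finset.univ K C (fun ω => spinAt x₃ ω * spinAt x₄ ω) +
              gksExpect Finset.univ K C (fun ω => spinAt a ω * spinAt x₃ ω) *
                gksExpect Finset.univ K C (fun ω => spinAt x₂ ω * spinAt x₄ ω) +
              gksExpect Finset.univ K C (fun ω => spinAt a ω * spinAt x₄ ω) *
                gksExpect Finset.univ K C (fun ω => spinAt x₂ ω * spinAt x₃ ω) -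
              gksExpect Finset.univ K C
                (fun ω => spinAt a ω * spinAt x₂ ω * spinAt x₃ ω * spinAt x₄ ω))) →
    ∀ Δ c : ℝ, 0 < c →
      Tendsto (fun x : Site 3 =>
        criticalTwoPoint 3 x * Real.sqrt (∑ i, ((x i : ℝ)) ^ 2) ^ (2 * Δ)) cofinite (nhds c) →
      ∀ T4 : (Fin 4 → EuclideanSpace ℝ (Fin 3)) → ℝ,
        TendstoLocallyUniformlyOn
          (fun k : ℕ => rescaledCorrelator (criticalCorr 3) (fun δ => δ ^ (-Δ)) 4 (((2:ℝ) ^ k)⁻¹))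
          T4 atTop (NonCoincident 3 4) →
        ∃ ν : (Fin 3 → EuclideanSpace ℝ (Fin 3)) → Measure (EuclideanSpace ℝ (Fin 3)),
          (∀ X, IsFiniteMeasure (ν X)) ∧
          (∀ X : Fin 3 → EuclideanSpace ℝ (Fin 3), (∀ j, X j ≠ 0) → ν X {0} = 0) ∧
          ∀ (X : Fin 3 → EuclideanSpace ℝ (Fin 3)) (x₁ : EuclideanSpace ℝ (Fin 3)),
            Matrix.vecCons x₁ X ∈ NonCoincident 3 4 →
              Integrable (fun z => c * ‖x₁ - z‖ ^ (-(2 * Δ))) (ν X) ∧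
              T4 (Matrix.vecCons x₁ X) -
                  (c * ‖x₁ - X 0‖ ^ (-(2 * Δ)) * (c * ‖X 1 - X 2‖ ^ (-(2 * Δ))) +
                    c * ‖x₁ - X 1‖ ^ (-(2 * Δ)) * (c * ‖X 0 - X 2‖ ^ (-(2 * Δ))) +
                    c * ‖x₁ - X 2‖ ^ (-(2 * Δ)) * (c * ‖X 0 - X 1‖ ^ (-(2 * Δ)))) =
                -∫ z, c * ‖x₁ - z‖ ^ (-(2 * Δ)) ∂(ν X) := by
  sorry

/-- **Stub (vertex covariance; CRUX-SIZED — unit-inversion covariance of the four-point function in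
vertex form).** For every witness `(Δ,c)` of item 0634, every dyadic canonical limit `T₄` and every family
of finite vertex measures representing its connected part as above, the measures transform under the unit
inversion `ι` by the Kelvin law: for triples `X` off the origin,
`ν_{ιX} = (∏ⱼ ‖Xⱼ‖^{2Δ}) · ι_*(‖z‖^{-2Δ} · ν_X)`. This is clause (c) of the crux at `n = 4`, rewritten
for ONE positive-measure-valued function of a triangle; the card proposes to reach it from a one-sided
domination by coupling arguments. OPEN. -/
theorem stub_vertexCovariance :
    ∀ Δ c : ℝ, 0 < c →
      Tendsto (fun x : Site 3 =>
        criticalTwoPoint 3 x * Real.sqrt (∑ i, ((x i : ℝ)) ^ 2) ^ (2 * Δ)) cofinite (nhds c) →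
      ∀ T4 : (Fin 4 → EuclideanSpace ℝ (Fin 3)) → ℝ,
        TendstoLocallyUniformlyOn
          (fun k : ℕ => rescaledCorrelator (criticalCorr 3) (fun δ => δ ^ (-Δ)) 4 (((2:ℝ) ^ k)⁻¹))
          T4 atTop (NonCoincident 3 4) →
        ∀ ν : (Fin 3 → EuclideanSpace ℝ (Fin 3)) → Measure (EuclideanSpace ℝ (Fin 3)),
          (∀ X, IsFiniteMeasure (ν X)) →
          (∀ (X : Fin 3 → EuclideanSpace ℝ (Fin 3)) (x₁ : EuclideanSpace ℝ (Fin 3)),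
            Matrix.vecCons x₁ X ∈ NonCoincident 3 4 →
              Integrable (fun z => c * ‖x₁ - z‖ ^ (-(2 * Δ))) (ν X) ∧
              T4 (Matrix.vecCons x₁ X) -
                  (c * ‖x₁ - X 0‖ ^ (-(2 * Δ)) * (c * ‖X 1 - X 2‖ ^ (-(2 * Δ))) +
                    c * ‖x₁ - X 1‖ ^ (-(2 * Δ)) * (c * ‖X 0 - X 2‖ ^ (-(2 * Δ))) +
                    c * ‖x₁ - X 2‖ ^ (-(2 * Δ)) * (c * ‖X 0 - X 1‖ ^ (-(2 * Δ)))) =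
                -∫ z, c * ‖x₁ - z‖ ^ (-(2 * Δ)) ∂(ν X)) →
          ∀ X : Fin 3 → EuclideanSpace ℝ (Fin 3), (∀ j, X j ≠ 0) → Function.Injective X →
            ν (fun j => inversion 0 1 (X j)) =
              ENNReal.ofReal (∏ j, ‖X j‖ ^ (2 * Δ)) •
                Measure.map (inversion (0 : EuclideanSpace ℝ (Fin 3)) 1)
                  ((ν X).withDensity fun z => ENNReal.ofReal (‖z‖ ^ (-(2 * Δ)))) := by
  sorry

/-- **Stub (Kelvin transform; PROVABLE NOW).** If the connected part of `T₄` (two-point function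
`c‖·‖^{-2Δ}`, `0 < c`, `0 < Δ`) is `−∫ c‖x₁ − z‖^{-2Δ} dν_X(z)` for finite measures `ν_X` that transform
under the unit inversion by the Kelvin law and have no atom at the origin for `X` off the origin, then `T₄`
is unit-inversion covariant with weight `Δ` at non-coincident configurations off the origin:
`‖ιx₁ − ιz‖ = ‖x₁ − z‖/(‖x₁‖‖z‖)` turns `∫‖ιx₁ − w‖^{-2Δ} d(ι_*(‖z‖^{-2Δ}ν_X))(w)` into
`‖x₁‖^{2Δ} ∫‖x₁ − z‖^{-2Δ} dν_X(z)`, and the Wick part is covariant term by term. -/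
theorem stub_inversionOfVertexCovariance :
    ∀ Δ c : ℝ, 0 < c → 0 < Δ →
      ∀ (T4 : (Fin 4 → EuclideanSpace ℝ (Fin 3)) → ℝ)
        (ν : (Fin 3 → EuclideanSpace ℝ (Fin 3)) → Measure (EuclideanSpace ℝ (Fin 3))),
        (∀ X, IsFiniteMeasure (ν X)) →
        (∀ (X : Fin 3 → EuclideanSpace ℝ (Fin 3)) (x₁ : EuclideanSpace ℝ (Fin 3)),
          Matrix.vecCons x₁ X ∈ NonCoincident 3 4 →
            Integrable (fun z => c * ‖x₁ - z‖ ^ (-(2 * Δ))) (ν X) ∧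
            T4 (Matrix.vecCons x₁ X) -
                (c * ‖x₁ - X 0‖ ^ (-(2 * Δ)) * (c * ‖X 1 - X 2‖ ^ (-(2 * Δ))) +
                  c * ‖x₁ - X 1‖ ^ (-(2 * Δ)) * (c * ‖X 0 - X 2‖ ^ (-(2 * Δ))) +
                  c * ‖x₁ - X 2‖ ^ (-(2 * Δ)) * (c * ‖X 0 - X 1‖ ^ (-(2 * Δ)))) =
              -∫ z, c * ‖x₁ - z‖ ^ (-(2 * Δ)) ∂(ν X)) →
        (∀ X : Fin 3 → EuclideanSpace ℝ (Fin 3), (∀ j, X j ≠ 0) → Function.Injective X →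
          ν (fun j => inversion 0 1 (X j)) =
            ENNReal.ofReal (∏ j, ‖X j‖ ^ (2 * Δ)) •
              Measure.map (inversion (0 : EuclideanSpace ℝ (Fin 3)) 1)
                ((ν X).withDensity fun z => ENNReal.ofReal (‖z‖ ^ (-(2 * Δ))))) →
        (∀ X : Fin 3 → EuclideanSpace ℝ (Fin 3), (∀ j, X j ≠ 0) → ν X {0} = 0) →
        ∀ x ∈ NonCoincident 3 4, (∀ i, x i ≠ 0) →
          T4 (fun i => inversion 0 1 (x i)) = (∏ i, ‖x i‖ ^ (2 * Δ)) * T4 x :=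
  -- LANDED p129418 (Theorems/PrecisionLaplacianMoebiusLimitOfTwoPointLawKelvinTransform.lean)
  Summit.CriticalPhenomena.Ising3DConformalLimit.PrecisionLaplacianMoebiusLimitOfTwoPointLaw.stub_inversionOfVertexCovariance

/-- **Stub (unit-inversion covariance of the dyadic limits of even arity `n ≥ 6`; CRUX-SIZED).** The
part of `I₂` this line does not factor (the card reaches even `n ≥ 6` only through the conjectural
amputated Shlosman signs and a multi-vertex calculus). OPEN. -/
theorem stub_inversionHigher :
    ∀ Δ c : ℝ, 0 < c →
      Tendsto (fun x : Site 3 =>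
        criticalTwoPoint 3 x * Real.sqrt (∑ i, ((x i : ℝ)) ^ 2) ^ (2 * Δ)) cofinite (nhds c) →
      ∀ n, 6 ≤ n → Even n → ∀ Tn : (Fin n → EuclideanSpace ℝ (Fin 3)) → ℝ,
        TendstoLocallyUniformlyOn
          (fun k : ℕ => rescaledCorrelator (criticalCorr 3) (fun δ => δ ^ (-Δ)) n (((2:ℝ) ^ k)⁻¹))
          Tn atTop (NonCoincident 3 n) →
        ∀ x ∈ NonCoincident 3 n, (∀ i, x i ≠ 0) →
          Tn (fun i => inversion 0 1 (x i)) = (∏ i, ‖x i‖ ^ (2 * Δ)) * Tn x := by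
  sorry

/-- **Stub (monopole lower bound for positive Riesz potentials; PROVABLE NOW; tooth).** If `ν ≠ 0` is a
finite positive measure on `ℝ³`, `0 < Δ`, `0 < c`, and the potential `∫ c‖x − z‖^{-2Δ} dν(z)` is a genuine
(convergent) integral for all `x` outside some compact set, then `‖x‖^{2Δ} ∫ c‖x − z‖^{-2Δ} dν(z)` does NOT
tend to `0` at infinity (it is eventually `≥ c 2^{-2Δ} ν(B_R) > 0` once `ν(B_R) > 0`). -/
theorem stub_monopoleLowerBound :
    ∀ Δ c : ℝ, 0 < Δ → 0 < c →
      ∀ ν : Measure (EuclideanSpace ℝ (Fin 3)), IsFiniteMeasure ν → ν ≠ 0 →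
        (∀ᶠ x in cocompact (EuclideanSpace ℝ (Fin 3)),
          Integrable (fun z => c * ‖x - z‖ ^ (-(2 * Δ))) ν) →
        ¬ Tendsto (fun x : EuclideanSpace ℝ (Fin 3) => ‖x‖ ^ (2 * Δ) * ∫ z, c * ‖x - z‖ ^ (-(2 * Δ)) ∂ν)
            (cocompact (EuclideanSpace ℝ (Fin 3))) (nhds 0) :=
  -- LANDED p129240 (Theorems/PrecisionLaplacianMoebiusLimitOfTwoPointLawMonopoleLowerBound.lean)
  Summit.CriticalPhenomena.Ising3DConformalLimit.PrecisionLaplacianMoebiusLimitOfTwoPointLaw.stub_monopoleLowerBound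

/-- **Stub (the barrier witness has no vertex measure; PROVABLE NOW — kernel-checked in the ideator's
sketch; tooth / D-0021 barrier evasion).** For the sharpened witness `ScaleNotMoebius.narrowFamily Δ` of
`Literature.Barriers.CriticalPhenomena.ScaleCovarianceNotMoebiusNarrow` (Euclidean, scale covariant, pure-power
two-point function with `c = 1`, all of the barrier's properties (1)–(13)), the connected four-point function
`−bump` decays like `‖x₁‖^{-4Δ}` in one variable, faster than any non-zero positive `I_{2Δ}`-potential, and is
not identically zero: so it admits NO vertex-measure representation. -/
theorem stub_narrowFamilyNoVertexMeasure :
    ∀ Δ : ℝ, 0 < Δ →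
      ¬ ∀ x₂ x₃ x₄ : EuclideanSpace ℝ (Fin 3), ∃ ν : Measure (EuclideanSpace ℝ (Fin 3)),
          IsFiniteMeasure ν ∧
            ∀ x₁ : EuclideanSpace ℝ (Fin 3),
              (![x₁, x₂, x₃, x₄] : Fin 4 → EuclideanSpace ℝ (Fin 3)) ∈ NonCoincident 3 4 →
                Integrable (fun z => (1 : ℝ) * ‖x₁ - z‖ ^ (-(2 * Δ))) ν ∧
                  limitConnectedFour (Literature.Barriers.CriticalPhenomena.ScaleNotMoebius.narrowFamily Δ)
                      ![x₁, x₂, x₃, x₄] =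
                    -∫ z, (1 : ℝ) * ‖x₁ - z‖ ^ (-(2 * Δ)) ∂ν :=
  -- LANDED p129317 (Theorems/PrecisionLaplacianMoebiusLimitOfTwoPointLawNarrowFamilyNoVertexMeasure.lean)
  Summit.CriticalPhenomena.Ising3DConformalLimit.PrecisionLaplacianMoebiusLimitOfTwoPointLaw.stub_narrowFamilyNoVertexMeasure

/-- **Stub (tooth; LANDED p150125 — box form of `stub_condCubicNonpos`).** The sum over four replicas of
`ν_{Λ;K}` (`Kᵢ ≥ 0`, `|Cᵢ| ≤ 2`) clamped at `(p, q, r)` to `(+,+,+)`, `(+,-,-)`, `(+,+,-)`, `(+,-,+)` of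
`(ξ_g + χ_g - ξ'_g - χ'_g) w(ξ)w(χ)w(ξ')w(χ')` is `≤ 0` (Ellis–Monroe expansion with three clamped sites over a
sign-twisted monomial class). Not used by `MoebiusLimitOfTwoPointLaw_of`. -/
theorem stub_boxSumNonpos :
    ∀ (n m : ℕ) (K : Fin m → ℝ) (C : Fin m → Finset (Fin n)), (∀ i, 0 ≤ K i) → (∀ i, (C i).card ≤ 2) →
      ∀ g p q r : Fin n,
        ∑ c : Cfg4 (Fin n),
          ((if spinAt p c.1 = 1 ∧ spinAt q c.1 = 1 ∧ spinAt r c.1 = 1 then (1 : ℝ) else 0) *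
            (if spinAt p c.2.1 = 1 ∧ spinAt q c.2.1 = -1 ∧ spinAt r c.2.1 = -1 then (1 : ℝ) else 0) *
            (if spinAt p c.2.2.1 = 1 ∧ spinAt q c.2.2.1 = 1 ∧ spinAt r c.2.2.1 = -1 then (1 : ℝ) else 0) *
            (if spinAt p c.2.2.2 = 1 ∧ spinAt q c.2.2.2 = -1 ∧ spinAt r c.2.2.2 = 1 then (1 : ℝ) else 0)) *
          (spinAt g c.1 + spinAt g c.2.1 - spinAt g c.2.2.1 - spinAt g c.2.2.2) *
          gksWeight4 Finset.univ K C c ≤ 0 :=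
  -- LANDED p150125 (Theorems/PrecisionLaplacianMoebiusLimitOfTwoPointLawBoxClampedEM.lean)
  Summit.CriticalPhenomena.Ising3DConformalLimit.PrecisionLaplacianMoebiusLimitOfTwoPointLaw.stub_boxSumNonpos

/-- **Stub (tooth; LANDED p150670 — conditional magnetisation given three spins has a nonpositive
cubic coefficient = the four-site member `F4` of the VP¹ family).** For the spin system `ν_{Λ;K}` on
`Fin n` with couplings `Kᵢ ≥ 0` on supports of at most two sites and sites `g p q r`, with the restricted
sums `Z_{st} = ∑_σ 1[σ_p = 1, σ_q = s, σ_r = t] w(σ)`, `N_{st} = ∑_σ 1[σ_p = 1, σ_q = s, σ_r = t] σ_g w(σ)`: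
`N_{++}Z_{--}Z_{+-}Z_{-+} + Z_{++}N_{--}Z_{+-}Z_{-+} ≤ Z_{++}Z_{--}N_{+-}Z_{-+} + Z_{++}Z_{--}Z_{+-}N_{-+}`, i.e.
`m(+,+,+) + m(+,-,-) ≤ m(+,+,-) + m(+,-,+)` for `m(s) = ⟨σ_g | (σ_p,σ_q,σ_r) = s⟩`; in zero field this is
`κ ≤ 0` for the coefficient of `σ_pσ_qσ_r` in `⟨σ_g | σ_p,σ_q,σ_r⟩`, equivalent to
`⟨σ_gσ_pσ_qσ_r⟩ ≤ (⟨σ_gσ_p⟩,⟨σ_gσ_q⟩,⟨σ_gσ_r⟩) Σ_{pqr}⁻¹ (⟨σ_qσ_r⟩,⟨σ_pσ_r⟩,⟨σ_pσ_q⟩)ᵀ` (VP¹ with `W = {p,q,r}`).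
Ellis–Monroe four-replica expansion with three clamped sites and a sign-twisted monomial class. Not used by
`MoebiusLimitOfTwoPointLaw_of`. -/
theorem stub_condCubicNonpos :
    ∀ (n m : ℕ) (K : Fin m → ℝ) (C : Fin m → Finset (Fin n)), (∀ i, 0 ≤ K i) → (∀ i, (C i).card ≤ 2) →
      ∀ g p q r : Fin n,
        gksSum Finset.univ K C (fun σ => (if spinAt p σ = 1 ∧ spinAt q σ = 1 ∧ spinAt r σ = 1 then 1 else 0) * spinAt g σ) *
            gksSum Finset.univ K C (fun σ => if spinAt p σ = 1 ∧ spinAt q σ = -1 ∧ spinAt r σ = -1 then 1 else 0) *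
            gksSum Finset.univ K C (fun σ => if spinAt p σ = 1 ∧ spinAt q σ = 1 ∧ spinAt r σ = -1 then 1 else 0) *
            gksSum Finset.univ K C (fun σ => if spinAt p σ = 1 ∧ spinAt q σ = -1 ∧ spinAt r σ = 1 then 1 else 0) +
          gksSum Finset.univ K C (fun σ => if spinAt p σ = 1 ∧ spinAt q σ = 1 ∧ spinAt r σ = 1 then 1 else 0) *
            gksSum Finset.univ K C (fun σ => (if spinAt p σ = 1 ∧ spinAt q σ = -1 ∧ spinAt r σ = -1 then 1 else 0) * spinAt g σ) *
            gksSum Finset.univ K C (fun σ => if spinAt p σ = 1 ∧ spinAt q σ = 1 ∧ spinAt r σ = -1 then 1 else 0) *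
            gksSum Finset.univ K C (fun σ => if spinAt p σ = 1 ∧ spinAt q σ = -1 ∧ spinAt r σ = 1 then 1 else 0) ≤
        gksSum Finset.univ K C (fun σ => if spinAt p σ = 1 ∧ spinAt q σ = 1 ∧ spinAt r σ = 1 then 1 else 0) *
            gksSum Finset.univ K C (fun σ => if spinAt p σ = 1 ∧ spinAt q σ = -1 ∧ spinAt r σ = -1 then 1 else 0) *
            gksSum Finset.univ K C (fun σ => (if spinAt p σ = 1 ∧ spinAt q σ = 1 ∧ spinAt r σ = -1 then 1 else 0) * spinAt g σ) *
            gksSum Finset.univ K C (fun σ => if spinAt p σ = 1 ∧ spinAt q σ = -1 ∧ spinAt r σ = 1 then 1 else 0) +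
          gksSum Finset.univ K C (fun σ => if spinAt p σ = 1 ∧ spinAt q σ = 1 ∧ spinAt r σ = 1 then 1 else 0) *
            gksSum Finset.univ K C (fun σ => if spinAt p σ = 1 ∧ spinAt q σ = -1 ∧ spinAt r σ = -1 then 1 else 0) *
            gksSum Finset.univ K C (fun σ => if spinAt p σ = 1 ∧ spinAt q σ = 1 ∧ spinAt r σ = -1 then 1 else 0) *
            gksSum Finset.univ K C (fun σ => (if spinAt p σ = 1 ∧ spinAt q σ = -1 ∧ spinAt r σ = 1 then 1 else 0) * spinAt g σ) :=
  -- LANDED p150670 (Theorems/PrecisionLaplacianMoebiusLimitOfTwoPointLawCondCubicNonpos.lean)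
  Summit.CriticalPhenomena.Ising3DConformalLimit.PrecisionLaplacianMoebiusLimitOfTwoPointLaw.stub_condCubicNonpos

/-! ## The VP¹ ≡ IM programme (lead c18): `stub_amputatedLebowitz ↔ PrecisionLaplacian.InverseMFerromagnet`

All statements in the `gksExpect` vocabulary of the two cruxes; `Σ = (⟨σ_pσ_q⟩)`,
`ν_X(z) = ∑ₐ (Σ⁻¹)_{z a} (−U₄(a; x₂,x₃,x₄))` is the VP¹ charge (the summand of `stub_amputatedLebowitz`). -/

/-- **Tooth E1 (VP¹ ⇒ IM at non-adjacent pairs with one endpoint of degree ≤ 3; lead c18).** Assume VP¹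
for every pair ferromagnet. Let `x ≠ y` lie in no common bond and let `y` lie in at most three bonds. Then
`(Σ⁻¹)_xy ≤ 0`. Proof: with `S = univ ∖ {x,y}` and the local field `h_y = ∑ⱼ bⱼ σ_{wⱼ}` (`c2_site`), the
Callen identity (`c2_integrate`) gives `PCov(x,y|S) = Res_S(tanh h_y, σ_x) = κ_y Res_S(σ_B, σ_x)` (`c2_three`,
`c2_res_lin`; `B = {w₀,w₁,w₂}`, degenerate cubics have zero residual, `c2_res_degen`); every ingredient of
`Res_S(σ_B, σ_x)` avoids `σ_y`, so it is computed in the star–triangle decimation `ν` of `y` (a pair ferromagnet on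
`Fin n` with `y` free), where `Res_S(σ_B,σ_x) = β_B(x) · (Σ_xx − Σ_xS Σ_SS⁻¹ Σ_Sx)` with the Schur factor `> 0` and
`β_B(x) = (Σ_ν⁻¹ u_B)(x) = −ν_B(x) ≤ 0` by VP¹ for `ν` (`x ∉ B`); `κ_y ≤ 0` then gives `PCov ≥ 0` and S1
(`stub_entry_nonpos_of_pcov`) the sign of the entry. -/
theorem stub_imNonadj_of_amputatedLebowitz :
    (∀ (n m : ℕ) (K : Fin m → ℝ) (C : Fin m → Finset (Fin n)), (∀ i, 0 ≤ K i) → (∀ i, (C i).card = 2) →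
      ∀ z x₂ x₃ x₄ : Fin n,
        0 ≤ ∑ a : Fin n,
          (Matrix.of fun (p q : Fin n) =>
              gksExpect Finset.univ K C (fun ω => spinAt p ω * spinAt q ω))⁻¹ z a *
            (gksExpect Finset.univ K C (fun ω => spinAt a ω * spinAt x₂ ω) *
                gksExpect Finset.univ K C (fun ω => spinAt x₃ ω * spinAt x₄ ω) +
              gksExpect Finset.univ K C (fun ω => spinAt a ω * spinAt x₃ ω) *
                gksExpect Finset.univ K C (fun ω => spinAt x₂ ω * spinAt x₄ ω) +
              gksExpect Finset.univ K C (fun ω => spinAt a ω * spinAt x₄ ω) *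
                gksExpect Finset.univ K C (fun ω => spinAt x₂ ω * spinAt x₃ ω) -
              gksExpect Finset.univ K C
                (fun ω => spinAt a ω * spinAt x₂ ω * spinAt x₃ ω * spinAt x₄ ω))) →
    ∀ (n m : ℕ) (K : Fin m → ℝ) (C : Fin m → Finset (Fin n)), (∀ i, 0 ≤ K i) → (∀ i, (C i).card = 2) →
      ∀ x y : Fin n, x ≠ y → (∀ i, ¬ (x ∈ C i ∧ y ∈ C i)) →
        (Finset.univ.filter (fun i => y ∈ C i)).card ≤ 3 →
        (Matrix.of fun p q : Fin n => gksExpect Finset.univ K C (fun ω => spinAt p ω * spinAt q ω))⁻¹ x y ≤ 0 :=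
  -- LANDED p155838 (Theorems/PrecisionLaplacianMoebiusLimitOfTwoPointLawAmpLebImNonadj.lean)
  Summit.CriticalPhenomena.Ising3DConformalLimit.PrecisionLaplacianMoebiusLimitOfTwoPointLaw.stub_imNonadj_of_amputatedLebowitz

/-- **Tooth (VP¹ ⇒ IM; lead c18).** VP¹ for every pair ferromagnet implies the crux `InverseMFerromagnet`
(stmt-CriticalPhenomena-4798): E1 (`stub_imNonadj_of_amputatedLebowitz`) feeds the landed bridges of the 4798 chain —
C3 `stub_row_deg_le_two` (rows of degree ≤ 2), C4 `stub_imDeg3_of_nonadj` (subdivision: systems of maximal degree ≤ 3)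
and C5 `stub_im_of_imDeg3` (contraction limit: all systems). -/
theorem stub_inverseM_of_amputatedLebowitz :
    (∀ (n m : ℕ) (K : Fin m → ℝ) (C : Fin m → Finset (Fin n)), (∀ i, 0 ≤ K i) → (∀ i, (C i).card = 2) →
      ∀ z x₂ x₃ x₄ : Fin n,
        0 ≤ ∑ a : Fin n,
          (Matrix.of fun (p q : Fin n) =>
              gksExpect Finset.univ K C (fun ω => spinAt p ω * spinAt q ω))⁻¹ z a *
            (gksExpect Finset.univ K C (fun ω => spinAt a ω * spinAt x₂ ω) *
                gksExpect Finset.univ K C (fun ω => spinAt x₃ ω * spinAt x₄ ω) +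
              gksExpect Finset.univ K C (fun ω => spinAt a ω * spinAt x₃ ω) *
                gksExpect Finset.univ K C (fun ω => spinAt x₂ ω * spinAt x₄ ω) +
              gksExpect Finset.univ K C (fun ω => spinAt a ω * spinAt x₄ ω) *
                gksExpect Finset.univ K C (fun ω => spinAt x₂ ω * spinAt x₃ ω) -
              gksExpect Finset.univ K C
                (fun ω => spinAt a ω * spinAt x₂ ω * spinAt x₃ ω * spinAt x₄ ω))) →
    Summit.CriticalPhenomena.Ising3DConformalLimit.Theses.PrecisionLaplacian.InverseMFerromagnet :=
  -- LANDED p155838 (Theorems/PrecisionLaplacianMoebiusLimitOfTwoPointLawAmpLebImNonadj.lean; registered via stub-add)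
  Summit.CriticalPhenomena.Ising3DConformalLimit.PrecisionLaplacianMoebiusLimitOfTwoPointLaw.stub_inverseM_of_amputatedLebowitz

/-- **Tooth (coincident triples; worker).** If `x₂, x₃, x₄` are not pairwise distinct the VP¹ charge is explicit
and nonnegative: two of the three Wick columns are columns of `Σ` (amputating to Kronecker deltas) and the
four-point column collapses to a two-point column (`σ_p² = 1`), e.g. `x₃ = x₄`:
`ν(z) = 2⟨σ_{x₂}σ_{x₃}⟩ δ_{z x₃} ≥ 0` (GKS-I); `Σ` is positive definite (`schur_posDef`), so `Σ⁻¹Σ = 1`. -/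
theorem stub_amputatedLebowitz_degenerate :
    ∀ (n m : ℕ) (K : Fin m → ℝ) (C : Fin m → Finset (Fin n)), (∀ i, 0 ≤ K i) → (∀ i, (C i).card = 2) →
      ∀ z x₂ x₃ x₄ : Fin n, ¬ (x₂ ≠ x₃ ∧ x₂ ≠ x₄ ∧ x₃ ≠ x₄) →
        0 ≤ ∑ a : Fin n,
          (Matrix.of fun (p q : Fin n) =>
              gksExpect Finset.univ K C (fun ω => spinAt p ω * spinAt q ω))⁻¹ z a *
            (gksExpect Finset.univ K C (fun ω => spinAt a ω * spinAt x₂ ω) *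
                gksExpect Finset.univ K C (fun ω => spinAt x₃ ω * spinAt x₄ ω) +
              gksExpect Finset.univ K C (fun ω => spinAt a ω * spinAt x₃ ω) *
                gksExpect Finset.univ K C (fun ω => spinAt x₂ ω * spinAt x₄ ω) +
              gksExpect Finset.univ K C (fun ω => spinAt a ω * spinAt x₄ ω) *
                gksExpect Finset.univ K C (fun ω => spinAt x₂ ω * spinAt x₃ ω) -
              gksExpect Finset.univ K C
                (fun ω => spinAt a ω * spinAt x₂ ω * spinAt x₃ ω * spinAt x₄ ω)) :=
  -- LANDED p153868 (Theorems/PrecisionLaplacianMoebiusLimitOfTwoPointLawAmpLebDegenerate.lean)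
  Summit.CriticalPhenomena.Ising3DConformalLimit.PrecisionLaplacianMoebiusLimitOfTwoPointLaw.stub_amputatedLebowitz_degenerate

/-- **Tooth (VP¹ at `z ∈ X` from IM + GKS-II; worker).** Assume `InverseMFerromagnet`. For pairwise distinct
`x₂, x₃, x₄` and `z = x₂` (the other two cases by symmetry): since `Σ⁻¹Σ = 1`,
`ν(x₂) = ∑ₐ (Σ⁻¹)_{x₂ a} (⟨σ_aσ_{x₂}⟩⟨σ_{x₃}σ_{x₄}⟩ − ⟨σ_aσ_{x₂}σ_{x₃}σ_{x₄}⟩)`; the `a = x₂` term vanishes, and for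
`a ≠ x₂` both factors are `≤ 0` (IM, and GKS-II `⟨σ_aσ_{x₂}σ_{x₃}σ_{x₄}⟩ ≥ ⟨σ_aσ_{x₂}⟩⟨σ_{x₃}σ_{x₄}⟩`,
`gksExpect_mul_gksExpect_le` after rewriting the products as `spinProduct`s of symmetric differences). -/
theorem stub_amputatedLebowitz_mem_of_inverseM :
    Summit.CriticalPhenomena.Ising3DConformalLimit.Theses.PrecisionLaplacian.InverseMFerromagnet →
    ∀ (n m : ℕ) (K : Fin m → ℝ) (C : Fin m → Finset (Fin n)), (∀ i, 0 ≤ K i) → (∀ i, (C i).card = 2) →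
      ∀ z x₂ x₃ x₄ : Fin n, (x₂ ≠ x₃ ∧ x₂ ≠ x₄ ∧ x₃ ≠ x₄) → (z = x₂ ∨ z = x₃ ∨ z = x₄) →
        0 ≤ ∑ a : Fin n,
          (Matrix.of fun (p q : Fin n) =>
              gksExpect Finset.univ K C (fun ω => spinAt p ω * spinAt q ω))⁻¹ z a *
            (gksExpect Finset.univ K C (fun ω => spinAt a ω * spinAt x₂ ω) *
                gksExpect Finset.univ K C (fun ω => spinAt x₃ ω * spinAt x₄ ω) +
              gksExpect Finset.univ K C (fun ω => spinAt a ω * spinAt x₃ ω) *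
                gksExpect Finset.univ K C (fun ω => spinAt x₂ ω * spinAt x₄ ω) +
              gksExpect Finset.univ K C (fun ω => spinAt a ω * spinAt x₄ ω) *
                gksExpect Finset.univ K C (fun ω => spinAt x₂ ω * spinAt x₃ ω) -
              gksExpect Finset.univ K C
                (fun ω => spinAt a ω * spinAt x₂ ω * spinAt x₃ ω * spinAt x₄ ω)) :=
  -- LANDED p153959 (Theorems/PrecisionLaplacianMoebiusLimitOfTwoPointLawAmpLebMemOfInverseM.lean)
  Summit.CriticalPhenomena.Ising3DConformalLimit.PrecisionLaplacianMoebiusLimitOfTwoPointLaw.stub_amputatedLebowitz_mem_of_inverseM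

/-- **Tooth (the ghost: IM ⇒ VP¹`(z ∉ X)` with the `X`-triangle raised; lead c18 / worker).** Assume
`InverseMFerromagnet`. For pairwise distinct `x₂,x₃,x₄`, `z ∉ {x₂,x₃,x₄}` and `ε > 0`, append three bonds
`{x₃,x₄}, {x₂,x₄}, {x₂,x₃}` of coupling `λ(ε) = (log cosh 3ε − log cosh ε)/4` (`0 ≤ λ(ε) ≤ ε`); then the VP¹ charge of
the enlarged system at `z` is `≥ 0`. Proof: attach a ghost site `g` (index `Fin.last n` of `Fin (n+1)`) to `x₂,x₃,x₄`
with coupling `ε`; IM at `(z,g)` and S1 read backwards (`(Σ⁻¹)_{zg} = −PCov(z,g|rest)/D`, `D > 0`) give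
`PCov(z,g|rest) ≥ 0`; Callen at `g` gives `PCov = κ(ε) Res_rest(σ_X, σ_z)` with `κ(ε) = (tanh 3ε − 3 tanh ε)/4 < 0`, so
`Res ≤ 0`; decimating `g` (`cosh(ε(s₂+s₃+s₄)) = e^{c} e^{λ(ε)(s₃s₄+s₂s₄+s₂s₃)}`) identifies `Res` with
`β_X(z) · Schur(z|rest)` of the triangle-raised system on `Fin n`, `Schur > 0`, and `ν_X(z) = −β_X(z)` there (`z ∉ X`). -/
theorem stub_amputatedLebowitz_triangle_of_inverseM :
    Summit.CriticalPhenomena.Ising3DConformalLimit.Theses.PrecisionLaplacian.InverseMFerromagnet →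
    ∀ (n m : ℕ) (K : Fin m → ℝ) (C : Fin m → Finset (Fin n)), (∀ i, 0 ≤ K i) → (∀ i, (C i).card = 2) →
      ∀ z x₂ x₃ x₄ : Fin n, (x₂ ≠ x₃ ∧ x₂ ≠ x₄ ∧ x₃ ≠ x₄) → ¬ (z = x₂ ∨ z = x₃ ∨ z = x₄) →
        ∀ ε : ℝ, 0 < ε → ∃ t : ℝ, 0 ≤ t ∧ t ≤ ε ∧
        0 ≤ ∑ a : Fin n,
          (Matrix.of fun (p q : Fin n) =>
              gksExpect Finset.univ (Fin.append K (fun _ : Fin 3 => t))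
                (Fin.append C ![{x₃, x₄}, {x₂, x₄}, {x₂, x₃}]) (fun ω => spinAt p ω * spinAt q ω))⁻¹ z a *
            (gksExpect Finset.univ (Fin.append K (fun _ : Fin 3 => t))
                  (Fin.append C ![{x₃, x₄}, {x₂, x₄}, {x₂, x₃}]) (fun ω => spinAt a ω * spinAt x₂ ω) *
                gksExpect Finset.univ (Fin.append K (fun _ : Fin 3 => t))
                  (Fin.append C ![{x₃, x₄}, {x₂, x₄}, {x₂, x₃}]) (fun ω => spinAt x₃ ω * spinAt x₄ ω) +
              gksExpect Finset.univ (Fin.append K (fun _ : Fin 3 => t))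
                  (Fin.append C ![{x₃, x₄}, {x₂, x₄}, {x₂, x₃}]) (fun ω => spinAt a ω * spinAt x₃ ω) *
                gksExpect Finset.univ (Fin.append K (fun _ : Fin 3 => t))
                  (Fin.append C ![{x₃, x₄}, {x₂, x₄}, {x₂, x₃}]) (fun ω => spinAt x₂ ω * spinAt x₄ ω) +
              gksExpect Finset.univ (Fin.append K (fun _ : Fin 3 => t))
                  (Fin.append C ![{x₃, x₄}, {x₂, x₄}, {x₂, x₃}]) (fun ω => spinAt a ω * spinAt x₄ ω) *
                gksExpect Finset.univ (Fin.append K (fun _ : Fin 3 => t))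
                  (Fin.append C ![{x₃, x₄}, {x₂, x₄}, {x₂, x₃}]) (fun ω => spinAt x₂ ω * spinAt x₃ ω) -
              gksExpect Finset.univ (Fin.append K (fun _ : Fin 3 => t))
                  (Fin.append C ![{x₃, x₄}, {x₂, x₄}, {x₂, x₃}])
                (fun ω => spinAt a ω * spinAt x₂ ω * spinAt x₃ ω * spinAt x₄ ω)) :=
  -- LANDED p155155 (Theorems/PrecisionLaplacianMoebiusLimitOfTwoPointLawAmpLebTriangleOfInverseM.lean)
  Summit.CriticalPhenomena.Ising3DConformalLimit.PrecisionLaplacianMoebiusLimitOfTwoPointLaw.stub_amputatedLebowitz_triangle_of_inverseM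

/-- **Tooth (removing the triangle: continuity `t → 0⁺`; worker).** If for every `ε > 0` some `t ∈ [0, ε]` makes
the VP¹ charge of the system with the three appended bonds `{x₃,x₄}, {x₂,x₄}, {x₂,x₃}` of coupling `t` nonnegative
at `z`, then the VP¹ charge of the original system is nonnegative at `z`: `t ↦ gksExpect` is continuous (finite
sums of exponentials over a positive normaliser), `Σ_t → Σ₀` positive definite (`schur_posDef`) so `Σ_t⁻¹ → Σ₀⁻¹`
(`continuousAt_matrix_inv`), and at `t = 0` the appended bonds drop out of every `gksExpect`. No sign or cardinality
hypothesis is needed. -/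
theorem stub_amputatedLebowitz_of_triangle_limit :
    ∀ (n m : ℕ) (K : Fin m → ℝ) (C : Fin m → Finset (Fin n)) (z x₂ x₃ x₄ : Fin n),
      (∀ ε : ℝ, 0 < ε → ∃ t : ℝ, 0 ≤ t ∧ t ≤ ε ∧
        0 ≤ ∑ a : Fin n,
          (Matrix.of fun (p q : Fin n) =>
              gksExpect Finset.univ (Fin.append K (fun _ : Fin 3 => t))
                (Fin.append C ![{x₃, x₄}, {x₂, x₄}, {x₂, x₃}]) (fun ω => spinAt p ω * spinAt q ω))⁻¹ z a *
            (gksExpect Finset.univ (Fin.append K (fun _ : Fin 3 => t))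
                  (Fin.append C ![{x₃, x₄}, {x₂, x₄}, {x₂, x₃}]) (fun ω => spinAt a ω * spinAt x₂ ω) *
                gksExpect Finset.univ (Fin.append K (fun _ : Fin 3 => t))
                  (Fin.append C ![{x₃, x₄}, {x₂, x₄}, {x₂, x₃}]) (fun ω => spinAt x₃ ω * spinAt x₄ ω) +
              gksExpect Finset.univ (Fin.append K (fun _ : Fin 3 => t))
                  (Fin.append C ![{x₃, x₄}, {x₂, x₄}, {x₂, x₃}]) (fun ω => spinAt a ω * spinAt x₃ ω) *
                gksExpect Finset.univ (Fin.append K (fun _ : Fin 3 => t))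
                  (Fin.append C ![{x₃, x₄}, {x₂, x₄}, {x₂, x₃}]) (fun ω => spinAt x₂ ω * spinAt x₄ ω) +
              gksExpect Finset.univ (Fin.append K (fun _ : Fin 3 => t))
                  (Fin.append C ![{x₃, x₄}, {x₂, x₄}, {x₂, x₃}]) (fun ω => spinAt a ω * spinAt x₄ ω) *
                gksExpect Finset.univ (Fin.append K (fun _ : Fin 3 => t))
                  (Fin.append C ![{x₃, x₄}, {x₂, x₄}, {x₂, x₃}]) (fun ω => spinAt x₂ ω * spinAt x₃ ω) -
              gksExpect Finset.univ (Fin.append K (fun _ : Fin 3 => t))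
                  (Fin.append C ![{x₃, x₄}, {x₂, x₄}, {x₂, x₃}])
                (fun ω => spinAt a ω * spinAt x₂ ω * spinAt x₃ ω * spinAt x₄ ω))) →
      0 ≤ ∑ a : Fin n,
          (Matrix.of fun (p q : Fin n) =>
              gksExpect Finset.univ K C (fun ω => spinAt p ω * spinAt q ω))⁻¹ z a *
            (gksExpect Finset.univ K C (fun ω => spinAt a ω * spinAt x₂ ω) *
                gksExpect Finset.univ K C (fun ω => spinAt x₃ ω * spinAt x₄ ω) +
              gksExpect Finset.univ K C (fun ω => spinAt a ω * spinAt x₃ ω) *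
                gksExpect Finset.univ K C (fun ω => spinAt x₂ ω * spinAt x₄ ω) +
              gksExpect Finset.univ K C (fun ω => spinAt a ω * spinAt x₄ ω) *
                gksExpect Finset.univ K C (fun ω => spinAt x₂ ω * spinAt x₃ ω) -
              gksExpect Finset.univ K C
                (fun ω => spinAt a ω * spinAt x₂ ω * spinAt x₃ ω * spinAt x₄ ω)) :=
  -- LANDED p154115 (Theorems/PrecisionLaplacianMoebiusLimitOfTwoPointLawAmpLebTriangleLimit.lean)
  Summit.CriticalPhenomena.Ising3DConformalLimit.PrecisionLaplacianMoebiusLimitOfTwoPointLaw.stub_amputatedLebowitz_of_triangle_limit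

/-- **Glue (IM ⇒ VP¹; sorry-free modulo the teeth).** Case analysis: coincident triple
(`stub_amputatedLebowitz_degenerate`), `z ∈ X` (`stub_amputatedLebowitz_mem_of_inverseM`), `z ∉ X`
(`stub_amputatedLebowitz_triangle_of_inverseM` + `stub_amputatedLebowitz_of_triangle_limit`). -/
theorem stub_amputatedLebowitz_of_inverseM :
    Summit.CriticalPhenomena.Ising3DConformalLimit.Theses.PrecisionLaplacian.InverseMFerromagnet →
    ∀ (n m : ℕ) (K : Fin m → ℝ) (C : Fin m → Finset (Fin n)), (∀ i, 0 ≤ K i) → (∀ i, (C i).card = 2) →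
      ∀ z x₂ x₃ x₄ : Fin n,
        0 ≤ ∑ a : Fin n,
          (Matrix.of fun (p q : Fin n) =>
              gksExpect Finset.univ K C (fun ω => spinAt p ω * spinAt q ω))⁻¹ z a *
            (gksExpect Finset.univ K C (fun ω => spinAt a ω * spinAt x₂ ω) *
                gksExpect Finset.univ K C (fun ω => spinAt x₃ ω * spinAt x₄ ω) +
              gksExpect Finset.univ K C (fun ω => spinAt a ω * spinAt x₃ ω) *
                gksExpect Finset.univ K C (fun ω => spinAt x₂ ω * spinAt x₄ ω) +
              gksExpect Finset.univ K C (fun ω => spinAt a ω * spinAt x₄ ω) *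
                gksExpect Finset.univ K C (fun ω => spinAt x₂ ω * spinAt x₃ ω) -
              gksExpect Finset.univ K C
                (fun ω => spinAt a ω * spinAt x₂ ω * spinAt x₃ ω * spinAt x₄ ω)) := by
  intro hIM n m K C hK hC z x₂ x₃ x₄
  by_cases hd : x₂ ≠ x₃ ∧ x₂ ≠ x₄ ∧ x₃ ≠ x₄
  · by_cases hz : z = x₂ ∨ z = x₃ ∨ z = x₄
    · exact stub_amputatedLebowitz_mem_of_inverseM hIM n m K C hK hC z x₂ x₃ x₄ hd hz
    · exact stub_amputatedLebowitz_of_triangle_limit n m K C z x₂ x₃ x₄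
        (fun ε hε => stub_amputatedLebowitz_triangle_of_inverseM hIM n m K C hK hC z x₂ x₃ x₄ hd hz ε hε)
  · exact stub_amputatedLebowitz_degenerate n m K C hK hC z x₂ x₃ x₄ hd

/-- **VP¹ ≡ IM (lead c18; sorry-free modulo the teeth of this section).** The line's lattice input
`stub_amputatedLebowitz` is equivalent to the crux `PrecisionLaplacian.InverseMFerromagnet` (stmt-CriticalPhenomena-4798). -/
theorem amputatedLebowitz_iff_inverseM :
    (∀ (n m : ℕ) (K : Fin m → ℝ) (C : Fin m → Finset (Fin n)), (∀ i, 0 ≤ K i) → (∀ i, (C i).card = 2) →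
      ∀ z x₂ x₃ x₄ : Fin n,
        0 ≤ ∑ a : Fin n,
          (Matrix.of fun (p q : Fin n) =>
              gksExpect Finset.univ K C (fun ω => spinAt p ω * spinAt q ω))⁻¹ z a *
            (gksExpect Finset.univ K C (fun ω => spinAt a ω * spinAt x₂ ω) *
                gksExpect Finset.univ K C (fun ω => spinAt x₃ ω * spinAt x₄ ω) +
              gksExpect Finset.univ K C (fun ω => spinAt a ω * spinAt x₃ ω) *
                gksExpect Finset.univ K C (fun ω => spinAt x₂ ω * spinAt x₄ ω) +
              gksExpect Finset.univ K C (fun ω => spinAt a ω * spinAt x₄ ω) *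
                gksExpect Finset.univ K C (fun ω => spinAt x₂ ω * spinAt x₃ ω) -
              gksExpect Finset.univ K C
                (fun ω => spinAt a ω * spinAt x₂ ω * spinAt x₃ ω * spinAt x₄ ω))) ↔
    Summit.CriticalPhenomena.Ising3DConformalLimit.Theses.PrecisionLaplacian.InverseMFerromagnet :=
  ⟨stub_inverseM_of_amputatedLebowitz, stub_amputatedLebowitz_of_inverseM⟩

/-- In particular the research stub of this line is exactly the neighbouring crux: `stub_amputatedLebowitz` proves
`InverseMFerromagnet` (and conversely). -/
theorem inverseM_of_stub : Summit.CriticalPhenomena.Ising3DConformalLimit.Theses.PrecisionLaplacian.InverseMFerromagnet :=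
  stub_inverseM_of_amputatedLebowitz stub_amputatedLebowitz

/-! ## Glue (no `sorry` below this line) -/

/-- `I₂` at arity 4 from the vertex-measure stubs: VP¹ → vertex measures → (crux-sized) vertex covariance →
Kelvin transform. `0 < Δ` is supplied by the two-point law (`twoPointLaw_exponent_pos`). -/
theorem inversionFour_of_stubs :
    ∀ Δ c : ℝ, 0 < c →
      Tendsto (fun x : Site 3 =>
        criticalTwoPoint 3 x * Real.sqrt (∑ i, ((x i : ℝ)) ^ 2) ^ (2 * Δ)) cofinite (nhds c) →
      ∀ T4 : (Fin 4 → EuclideanSpace ℝ (Fin 3)) → ℝ,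
        TendstoLocallyUniformlyOn
          (fun k : ℕ => rescaledCorrelator (criticalCorr 3) (fun δ => δ ^ (-Δ)) 4 (((2:ℝ) ^ k)⁻¹))
          T4 atTop (NonCoincident 3 4) →
        ∀ x ∈ NonCoincident 3 4, (∀ i, x i ≠ 0) →
          T4 (fun i => inversion 0 1 (x i)) = (∏ i, ‖x i‖ ^ (2 * Δ)) * T4 x := by
  intro Δ c hc hP T4 hT4 x hx h0
  have hΔ : 0 < Δ := twoPointLaw_exponent_pos hc hP
  obtain ⟨ν, hfin, h0ν, hVM⟩ := stub_vertexMeasureOfLimit stub_amputatedLebowitz Δ c hc hP T4 hT4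
  have hVC := stub_vertexCovariance Δ c hc hP T4 hT4 ν hfin hVM
  exact stub_inversionOfVertexCovariance Δ c hc hΔ T4 ν hfin hVM hVC h0ν x hx h0

/-- `I₂` (unit-inversion covariance of every dyadic canonical limit of even arity `n ≥ 4`), by cases:
`n = 4` from `inversionFour_of_stubs`, even `n ≥ 6` from `stub_inversionHigher`. -/
theorem dyadicInversion_of_stubs :
    ∀ Δ c : ℝ, 0 < c →
      Tendsto (fun x : Site 3 =>
        criticalTwoPoint 3 x * Real.sqrt (∑ i, ((x i : ℝ)) ^ 2) ^ (2 * Δ)) cofinite (nhds c) →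
      ∀ n, 4 ≤ n → Even n → ∀ Tn : (Fin n → EuclideanSpace ℝ (Fin 3)) → ℝ,
        TendstoLocallyUniformlyOn
          (fun k : ℕ => rescaledCorrelator (criticalCorr 3) (fun δ => δ ^ (-Δ)) n (((2:ℝ) ^ k)⁻¹))
          Tn atTop (NonCoincident 3 n) →
        ∀ x ∈ NonCoincident 3 n, (∀ i, x i ≠ 0) →
          Tn (fun i => inversion 0 1 (x i)) = (∏ i, ‖x i‖ ^ (2 * Δ)) * Tn x := by
  intro Δ c hc hP n h4 he Tn hTn x hx h0
  rcases Nat.lt_or_ge n 6 with hlt | hge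
  · have h4' : n = 4 := by
      obtain ⟨k, hk⟩ := he
      omega
    subst h4'
    exact inversionFour_of_stubs Δ c hc hP Tn hTn x hx h0
  · exact stub_inversionHigher Δ c hc hP n hge he Tn hTn x hx h0

/-- **Item-level exact residue (lead c19; re-export of p157903).** With item 8367 proved, the crux is EXACTLY
"item 0634 → (item 4738 `WeylWindow.LimitExists` ∧ item 1982 `HyperoctahedralRP.InversionUpgradeNormalised`)": the two
open problems this line's open stubs sit under (`stub_dyadicLimit` below 4738; `stub_vertexCovariance`/`stub_inversionHigher`
below 1982). -/
theorem crux_iff_subs :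
    MoebiusLimitOfTwoPointLaw ↔
      (Summit.CriticalPhenomena.Ising3DConformalLimit.Theses.IsingEuclidUpgrade.IsingEuclidUpgradeR2RotInvPowerLaw →
        Summit.CriticalPhenomena.Ising3DConformalLimit.Theses.WeylWindow.LimitExists ∧
          Summit.CriticalPhenomena.Ising3DConformalLimit.Theses.HyperoctahedralRP.InversionUpgradeNormalised) :=
  Summit.CriticalPhenomena.Ising3DConformalLimit.PrecisionLaplacianMoebiusLimitOfTwoPointLawSplit.moebiusLimitOfTwoPointLaw_iff_subs

-- The planners' split glue `MoebiusLimitOfTwoPointLaw_of_subs : LimitExists → InversionUpgradeNormalised → crux` is the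
-- landed `PrecisionLaplacianMoebiusLimitOfTwoPointLawSplit.MoebiusLimitOfTwoPointLaw_of_subs` (p157903); it is deliberately NOT
-- re-exported here, so that the skeleton's deciding theorem stays `MoebiusLimitOfTwoPointLaw_of` (closed = False).

/-- **Composition (glue only): the crux from the stubs**, through the landed
`moebiusLimitOfTwoPointLaw_of_dyadic : D₂ → I₂ → crux` (p128000). The `sorry`s in its closure are exactly
`stub_dyadicLimit`, `stub_amputatedLebowitz`, `stub_vertexMeasureOfLimit`, `stub_vertexCovariance`,
`stub_inversionOfVertexCovariance`, `stub_inversionHigher`. -/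
theorem MoebiusLimitOfTwoPointLaw_of : MoebiusLimitOfTwoPointLaw :=
  moebiusLimitOfTwoPointLaw_of_dyadic stub_dyadicLimit dyadicInversion_of_stubs

/-- The same under the second host route's spelling (`Theses.BernsteinTemperature`, identical definiens). -/
theorem MoebiusLimitOfTwoPointLaw_of' :
    Summit.CriticalPhenomena.Ising3DConformalLimit.Theses.BernsteinTemperature.MoebiusLimitOfTwoPointLaw :=
  MoebiusLimitOfTwoPointLaw_of

end Summit.CriticalPhenomena.Ising3DConformalLimit.Cruxes.MoebiusLimitOfTwoPointLaw.AmputatedLebowitz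

end
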